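import Summits.BirchSwinnertonDyer.BirchSwinnertonDyer.Theses.SelmerRank

/-!
# Negative lemma for crux `SelmerRankLB` (stmt-BirchSwinnertonDyer-0131):
# no hypothesis of the crux is load-bearing — a counterexample to the crux refutes the summit

Refuter / crux-disprover file (Negative lane, `--supports stmt-BirchSwinnertonDyer-0131`; it does
NOT refute the crux and asserts no route statement). The crux (shared verbatim by the routes
SelmerRank / ShadowIsolation / ToricShedding / FrozenTwin / TangentCone / VerticalContact, whose six
`def SelmerRankLB` bodies are `rfl`-equal) is

  `∀ W [IsElliptic] [IsGloballyMinimal] p [p.Prime], 5 ≤ p → good at p → p ∤ a_p(W) → ρ̄_{W,p} onto →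
     r_an(W) ≤ corank_{ℤ_p} Sel_{p^∞}(W/ℚ)`.

The usual load-bearing analysis of a crux disprover — "drop hypothesis `H`, exhibit a witness, land
`<crux>_false_without_H`" — is IMPOSSIBLE here for every one of the five hypotheses, and this file
records WHY as kernel-checked implications: the summit statement `BirchSwinnertonDyer`
(`r_an = rank` for every elliptic `W/ℚ`) together with the corank identity
`corank Sel_{p^∞} = rank + corank Ш[p^∞]`, a THEOREM of the tree
(`WeierstrassCurve.selmerCorank_eq_mordellWeilRank_add_holds`, Greenberg LNM 1716 §1), gives the
crux with ALL hypotheses dropped (`analyticRank_le_selmerCorank_of_summit`: every elliptic `W`,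
every prime `p` — bad, supersingular, `2`, `3`, non-minimal model, small image included). Hence
(`not_summit_of_selmerCorank_lt`) a single pair `(W, p)` with `corank_p Sel_{p^∞}(W) < r_an(W)` — in
particular any counterexample to the crux (`not_summit_of_not_selmerRankLB`) — is a DISPROOF OF THE
LEAN SUMMIT. Consequences recorded for planners and provers:

* the crux cannot be "refuted-misstated": its side conditions (`p ≥ 5`, good, ordinary, surjective
  image, global minimality) are provability scaffolding — exactly the hypotheses of the known cases
  `r_an ≤ 3` (`p`-parity + the corank-0/1 `p`-converses) — not truth conditions;
* no finite instance is decidable in the present tree anyway: `analyticRank` is bounded below in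
  tree only for the CM congruent-number curves (Hecke continuation), which the surjectivity
  hypothesis excludes (crux work-file `Cruxes/SelmerRankLB/Disproof.lean`, §(B));
* the same immunity descends to the open stub `stub_delta_evenGap` of the picked line
  `kurihara_order` modulo Kim 2022 Thm 1.9 (1) (work-file §(D), `stubKV_of_summit_of_kim`).
[folklore]
-/

-- the problem directory `BirchSwinnertonDyer/BirchSwinnertonDyer` forces the duplicated namespace segment
set_option linter.dupNamespace false

noncomputable section

namespace Summit.BirchSwinnertonDyer.BirchSwinnertonDyer.Theorems

open Summit.BirchSwinnertonDyer.BirchSwinnertonDyer.Theses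

/-- **The crux with every hypothesis dropped follows from the summit.** If `r_an(W) = rank W(ℚ)` for
every elliptic `W/ℚ` (the Lean summit `BirchSwinnertonDyer`), then `r_an(W) ≤ corank_{ℤ_p} Sel_{p^∞}(W/ℚ)`
for every elliptic `W` and EVERY prime `p`, by the proved identity `corank Sel = rank + corank Ш[p^∞]`
(Greenberg LNM 1716 §1; tree theorem `WeierstrassCurve.selmerCorank_eq_mordellWeilRank_add_holds`).
[folklore] -/
theorem SelmerRankLBNegative.analyticRank_le_selmerCorank_of_summit (h : _root_.BirchSwinnertonDyer)
    (W : WeierstrassCurve ℚ) [W.IsElliptic] (p : ℕ) [Fact p.Prime] :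
    W.analyticRank ≤ W.selmerCorank p := by
  have h1 : W.analyticRank = W.mordellWeilRank := h W inferInstance
  have h2 : W.selmerCorank p = W.mordellWeilRank + W.shaCorank p :=
    W.selmerCorank_eq_mordellWeilRank_add_holds p
  omega

/-- **One pair `(W, p)` with `corank_p Sel_{p^∞}(W/ℚ) < r_an(W)` refutes the Lean summit** — whatever
the reduction type of `p`, the image of `ρ̄_{W,p}`, or the model. This is the only shape a
counterexample to the crux `SelmerRankLB` (or to any weakening of its hypotheses) can have. [folklore] -/
theorem SelmerRankLBNegative.not_summit_of_selmerCorank_lt (W : WeierstrassCurve ℚ) [W.IsElliptic]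
    (p : ℕ) [Fact p.Prime] (hlt : W.selmerCorank p < W.analyticRank) : ¬ _root_.BirchSwinnertonDyer :=
  fun h ↦ absurd (SelmerRankLBNegative.analyticRank_le_selmerCorank_of_summit h W p) (not_le.mpr hlt)

/-- **A counterexample to the crux `SelmerRankLB` is a counterexample to the summit**: the crux is
NECESSARY for `BirchSwinnertonDyer`, with none of its five hypotheses used. Hence no
`selmerRankLB_false_without_<H>` lemma exists for any hypothesis `H` unless `¬ BirchSwinnertonDyer`
is a theorem. (Stated for the item's original route decl `SelmerRank.SelmerRankLB`; the other five
route copies are `rfl`-equal.) [folklore] -/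
theorem SelmerRankLBNegative.not_summit_of_not_selmerRankLB (h : ¬ SelmerRank.SelmerRankLB) :
    ¬ _root_.BirchSwinnertonDyer :=
  fun hS ↦ h fun W _ _ p _ _ _ _ _ ↦
    SelmerRankLBNegative.analyticRank_le_selmerCorank_of_summit hS W p

end Summit.BirchSwinnertonDyer.BirchSwinnertonDyer.Theorems

end
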